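/-
Copyright (c) 2026 the pub-hodgecm-mathlib formalisation cell (harness21).  Prover seat hodgecm-mathlib-LH5-p02 (g11): E1 row 47c-4χ(b) «THE ISOTYPIC EULER IDENTITY» (pre-dealt by the
47d consumer F0P3a-p04 (g31); keeper F0P3a-p03 (g30)); over ★ 47c FILES 1–4 (F0P3-p02 (g26)) and ★ 4χ(a) `EigenRestrictionGradedShift` (this seat), 2026-09-03.
-/
import Literature.NumberTheory.Automorphic.JacquetEulerBlockPermutation   -- ★ 47c FILE 4 (F0P3-p02): `jacquetMap_shortExact_sub_id`; brings FILE 3 (`isInternal_heightPiece_jacquet_and_shift`, `injective_jacquetModule_sub_id`, `map_block_eq_block_act`), FILE 2b, FILE 1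
import Literature.LinearAlgebra.EigenRestrictionGradedShift                -- ★ 47c-4χ(a) (this seat): `finrank_quotient_range_restrict_sub_id_eq`, `finrank_biSup_inf_eigen_eq_sum`, `finrank_quotient_range_restrict_eq_of_exact`
import HarnessLib

/-!
# The isotypic Euler identity of the Jacquet module of a two-term resolution by block-permutation modules

Topic `NumberTheory/Automorphic`; declarations in the `Representation` namespace (dot-style extension, as ★ 47c FILES 3–4).  THEOREMS ONLY (no definition, instance, notation, named fact, `sorry`).
Cell `pub/hodgecm-mathlib` (D-0151), crux H413 = `stmt-HodgeConjecture-24833`, lane `--supports`; E1 census row 47 (F0P3-p02 (g26)) §2 (A3) ISOTYPE BY ISOTYPE under the compact torus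
(F0P3a-p04 (g31) «χ'-GAP», 2026-09-03T02:44Z); this is 47c-4χ(b), the instantiation of ★ `Literature.LinearAlgebra.EigenRestrictionGradedShift` (4χ(a)) in the letters of ★ 47c FILE 3∕4.
Count-neutral generic base layer; (R-SS) NOT chartered; E1 = PRINT until the keeper's charter test; HC_CM is proved only modulo the 2 remaining named inputs (hLiu418 =
`stmt-HodgeConjecture-24832`, h413 = `stmt-HodgeConjecture-24833`) until rung 0 closes.

SETTING (★ FILE 4's, verbatim) plus: a subgroup `C ≤ M` (the compact torus `T_c`) commuting with the torus element `τ` and FIXING the orbit representatives (`act_q c r = r`, `r ∈ R_q` — the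
apartment representatives), a scalar function `χ' : C → k` (a character, but only its values are used), and — HYPOTHESIS-STYLE — the simultaneous `χ'`-eigenspaces `E_q ≤ (M_q)_N`,
`E_V ≤ V_N` of the `C`-action `c ↦ r(c)` on the three Jacquet modules.  THE ONE ANALYTIC INPUT is `hsurj`: `r(g)` maps `E₀` ONTO `E_V` (exactness of `χ'`-isotypic parts — for compact `C`
acting smoothly this is ★ `CompactOpenAveragingExact.exact_fixedPoints_of_exact` on the `χ'⁻¹`-twist; discharged by the consumer 47d).
* §1 `r(c)` commutes with `r(τ)` and PRESERVES every block image `[W_b]` (`b` arbitrary: `[W_b] = [W_{rep b}]` and `c` fixes `rep b`), hence every height piece.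
* §2 ★ 4χ(a) §3 here: `r(τ)|_{E} − 1` is injective and `finrank (E ⧸ (r(τ)|_E − 1)E) = finrank (M_N⁽⁰⁾ ⊓ E)`.
* §3 ★ 4χ(a) §4 here: `finrank (M_N⁽⁰⁾ ⊓ E) = Σ_{r ∈ R₀} finrank ([W_r] ⊓ E)` (`SupIndep` from ★ FILE 2b `disjoint_biSup_map_mk`).
* §4 **THE ISOTYPIC EULER IDENTITY** `Σ_{r ∈ S₁} finrank ([W¹_r] ⊓ E₁) = Σ_{r ∈ S₀} finrank ([W⁰_r] ⊓ E₀)` (★ 4χ(a) §5 isotypic snake on the Jacquet row of ★ FILE 4) — the (E)-currency of 47d: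
  `[W^q_r] ⊓ E_q` is the `χ'`-eigenspace of `C` in the image of the block `W^q_r` in `(M_q)_N`, i.e. of `(V^{U_F})_{N ∩ P_F}` at the datum (★ FILE 2b `finrank_map_mk_block_eq` is the
  `Q_r`-bridge).

## References
* [BernsteinZelevinsky1976] I. N. Bernstein, A. V. Zelevinsky, *Representations of the group `GL(n,F)`*, Russian Math. Surveys 31 (1976), §2.3 (Jacquet modules; isotypic components).
* [Casselman1995] W. Casselman, *Introduction to the theory of admissible representations of `p`-adic reductive groups* (1995 notes), §3.2, §6.3.
* [SchneiderStuhler1997] P. Schneider, U. Stuhler, *Representation theory and sheaves on the Bruhat–Tits building*, Publ. Math. IHÉS 85 (1997), Ch. III §4.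
* [Brown1982] K. S. Brown, *Cohomology of Groups* (1982), III §5–§6.
-/

set_option autoImplicit false

open scoped BigOperators DirectSum

namespace Representation

open Literature.NumberTheory.Automorphic Function Module

/-! ## §1 The compact torus on the Jacquet module: commutation with `r(τ)`, block images and height pieces are preserved -/

section Torus

variable {k G M : Type*} [Field k] [Group G] [AddCommGroup M] [Module k M] (t : ParabolicTriple G) {ρ : Representation k G M}
variable {β : Type*} {Blk : β → Submodule k M} {act : G → β → β}

/-- `r(τ) ∘ r(c) = r(c) ∘ r(τ)` on the Jacquet module when `c τ = τ c` in `M`. [cite: BernsteinZelevinsky1976, §2.3] -/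
theorem jacquetModule_comp_comm {τ c : G} (hτ : τ ∈ t.M) (hc : c ∈ t.M) (hcτ : c * τ = τ * c) :
    (ρ.jacquetModule t ⟨τ, hτ⟩ : (t.restrict ρ).Coinvariants →ₗ[k] _) ∘ₗ (ρ.jacquetModule t ⟨c, hc⟩ : _ →ₗ[k] _) =
      (ρ.jacquetModule t ⟨c, hc⟩ : _ →ₗ[k] _) ∘ₗ (ρ.jacquetModule t ⟨τ, hτ⟩ : _ →ₗ[k] _) := by
  rw [← Module.End.mul_eq_comp, ← Module.End.mul_eq_comp, ← map_mul, ← map_mul]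
  congr 1
  exact Subtype.ext hcτ.symm

/-- `r(c)` PRESERVES the image `[W_r]` of a block whose index `c` fixes (`c · r = r`): `r(c)[W_r] = [ρ(c) W_r] = [W_{c·r}] = [W_r]`. [cite: Casselman1995, §6.3] -/
theorem map_jacquetModule_map_mk_block_eq (hact : ∀ g g' b, act (g * g') b = act g (act g' b)) (hact1 : ∀ b, act 1 b = b)
    (hperm : ∀ g b m, m ∈ Blk b → ρ g m ∈ Blk (act g b)) {c : G} (hc : c ∈ t.M) {r : β} (hcr : act c r = r) :
    ((Blk r).map (Coinvariants.mk (t.restrict ρ))).map (ρ.jacquetModule t ⟨c, hc⟩ : _ →ₗ[k] _) = (Blk r).map (Coinvariants.mk (t.restrict ρ)) := by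
  have hcomp : (ρ.jacquetModule t ⟨c, hc⟩ : _ →ₗ[k] _) ∘ₗ Coinvariants.mk (t.restrict ρ) = Coinvariants.mk (t.restrict ρ) ∘ₗ (ρ c : M →ₗ[k] M) := by
    ext v
    exact jacquetModule_mk ρ t ⟨c, hc⟩ v
  rw [← Submodule.map_comp, hcomp, Submodule.map_comp, map_block_eq_block_act (ρ := ρ) hact hact1 hperm c r, hcr]

/-- `r(c)` PRESERVES every height piece `M_N⁽ⁿ⁾ = ⨆_{r ∈ R, ht r = n} [W_r]` when `c` fixes the representatives `R`. [cite: Casselman1995, §6.3] -/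
theorem apply_jacquetModule_mem_heightPiece (hact : ∀ g g' b, act (g * g') b = act g (act g' b)) (hact1 : ∀ b, act 1 b = b)
    (hperm : ∀ g b m, m ∈ Blk b → ρ g m ∈ Blk (act g b)) {R : Set β} (ht : β → ℤ) {c : G} (hc : c ∈ t.M) (hcR : ∀ r ∈ R, act c r = r) (n : ℤ)
    {x : (t.restrict ρ).Coinvariants} (hx : x ∈ ⨆ r ∈ {r | r ∈ R ∧ ht r = n}, (Blk r).map (Coinvariants.mk (t.restrict ρ))) :
    (ρ.jacquetModule t ⟨c, hc⟩ : _ →ₗ[k] _) x ∈ ⨆ r ∈ {r | r ∈ R ∧ ht r = n}, (Blk r).map (Coinvariants.mk (t.restrict ρ)) := by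
  have hle : (⨆ r ∈ {r | r ∈ R ∧ ht r = n}, (Blk r).map (Coinvariants.mk (t.restrict ρ))).map (ρ.jacquetModule t ⟨c, hc⟩ : _ →ₗ[k] _) ≤
      ⨆ r ∈ {r | r ∈ R ∧ ht r = n}, (Blk r).map (Coinvariants.mk (t.restrict ρ)) := by
    rw [Submodule.map_iSup]
    refine iSup_mono fun r => ?_
    rw [Submodule.map_iSup]
    refine iSup_mono fun hr => ?_
    rw [map_jacquetModule_map_mk_block_eq t hact hact1 hperm hc (hcR r hr.1)]
  exact hle (Submodule.mem_map_of_mem hx)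

/-- The `SupIndep` form of ★ FILE 2b `disjoint_biSup_map_mk` on a finite set of representatives, for the REP-NORMALISED block images `r ↦ [W_{rep r}]` (which agree with `[W_r]` on `R`).
[cite: Brown1982, III §5] -/
theorem supIndep_map_mk_block_rep [DecidableEq β] (h : DirectSum.IsInternal Blk) (hact : ∀ g g' b, act (g * g') b = act g (act g' b)) (hact1 : ∀ b, act 1 b = b)
    (hperm : ∀ g b m, m ∈ Blk b → ρ g m ∈ Blk (act g b)) {R : Set β} (rep : β → β) (tr : β → G) (htrN : ∀ b, tr b ∈ t.N)
    (htr : ∀ b, act (tr b) (rep b) = b) (hrep_act : ∀ n ∈ t.N, ∀ b, rep (act n b) = rep b) (hrep_id : ∀ r ∈ R, rep r = r)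
    (S : Finset β) (hS : ∀ r ∈ S, r ∈ R) :
    S.SupIndep fun r => (Blk (rep r)).map (Coinvariants.mk (t.restrict ρ)) := by
  classical
  -- the `N ≤ P` data in ★ FILE 2b's currency
  let tr' : β → ↥(t.N.subgroupOf t.P) := fun b => ⟨⟨tr b, t.N_le (htrN b)⟩, Subgroup.mem_subgroupOf.2 (htrN b)⟩
  have hact' : ∀ (n n' : ↥(t.N.subgroupOf t.P)) (b : β), act (((n * n' : ↥(t.N.subgroupOf t.P)) : t.P) : G) b = act ((n : t.P) : G) (act ((n' : t.P) : G) b) :=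
    fun n n' b => hact _ _ b
  have hact1' : ∀ b : β, act (((1 : ↥(t.N.subgroupOf t.P)) : t.P) : G) b = b := fun b => hact1 b
  have hperm' : ∀ (n : ↥(t.N.subgroupOf t.P)) (b : β) (m : M), m ∈ Blk b → t.restrict ρ n m ∈ Blk (act ((n : t.P) : G) b) := fun n b m hm => hperm _ b m hm
  have htr' : ∀ b, act (((tr' b : ↥(t.N.subgroupOf t.P)) : t.P) : G) (rep b) = b := fun b => htr b
  have hrep_act' : ∀ (n : ↥(t.N.subgroupOf t.P)) (b : β), rep (act ((n : t.P) : G) b) = rep b := fun n b => hrep_act _ (Subgroup.mem_subgroupOf.1 n.2) b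
  rw [Finset.supIndep_iff_disjoint_erase]
  intro i hi
  have hiR : i ∈ R := hS i hi
  have hdisj := disjoint_biSup_map_mk (τ := t.restrict ρ) (act := fun n b => act ((n : t.P) : G) b) h hact' hact1' hperm' rep tr' htr' hrep_act' hrep_id
    (S₁ := {i}) (S₂ := (↑(S.erase i) : Set β)) (by intro r hr; rw [Set.mem_singleton_iff.1 hr]; exact hiR)
    (fun r hr => hS r (Finset.mem_of_mem_erase (Finset.mem_coe.1 hr)))
    (Set.disjoint_singleton_left.2 fun hmem => Finset.notMem_erase i S (Finset.mem_coe.1 hmem))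
  have h1 : (⨆ r ∈ ({i} : Set β), (Blk r).map (Coinvariants.mk (t.restrict ρ))) = (Blk (rep i)).map (Coinvariants.mk (t.restrict ρ)) := by
    rw [hrep_id i hiR]
    refine le_antisymm (iSup₂_le fun r hr => by rw [Set.mem_singleton_iff.1 hr]) (le_iSup₂_of_le i rfl le_rfl)
  have h2 : (S.erase i).sup (fun r => (Blk (rep r)).map (Coinvariants.mk (t.restrict ρ))) ≤ ⨆ r ∈ (↑(S.erase i) : Set β), (Blk r).map (Coinvariants.mk (t.restrict ρ)) := by
    rw [Finset.sup_eq_iSup]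
    refine iSup₂_le fun r hr => ?_
    rw [hrep_id r (hS r (Finset.mem_of_mem_erase hr))]
    exact le_iSup₂_of_le r (Finset.mem_coe.2 hr) le_rfl
  rw [← h1]
  exact hdisj.mono_right h2

end Torus

/-! ## §2–§4 The eigen-restricted grading, the block sum, and the isotypic Euler identity -/

section Isotypic

variable {k G : Type*} [Field k] [Group G] (t : ParabolicTriple G)
variable {M : Type*} [AddCommGroup M] [Module k M] {ρ : Representation k G M}
variable {β : Type*} [DecidableEq β] {Blk : β → Submodule k M} {act : G → β → β} (h : DirectSum.IsInternal Blk)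
  (hact : ∀ g g' b, act (g * g') b = act g (act g' b)) (hact1 : ∀ b, act 1 b = b) (hperm : ∀ g b m, m ∈ Blk b → ρ g m ∈ Blk (act g b))
  {R : Set β} (rep : β → β) (tr : β → G) (htrN : ∀ b, tr b ∈ t.N) (hrepR : ∀ b, rep b ∈ R) (htr : ∀ b, act (tr b) (rep b) = b)
  (hrep_act : ∀ n ∈ t.N, ∀ b, rep (act n b) = rep b) (hrep_id : ∀ r ∈ R, rep r = r) (ht : β → ℤ) (hfd : ∀ b, FiniteDimensional k (Blk b))
  {τ : G} (hτ : τ ∈ t.M) (hsh : ∀ r ∈ R, ht (rep (act τ r)) = ht r + 1) (hsh' : ∀ r' ∈ R, ∃ r ∈ R, rep (act τ r) = r')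
-- the compact torus data
variable (C : Subgroup G) (hCM : C ≤ t.M) (hCτ : ∀ c ∈ C, c * τ = τ * c) (hCR : ∀ c ∈ C, ∀ r ∈ R, act c r = r) (χ' : C → k)
  {E : Submodule k (t.restrict ρ).Coinvariants} (hE : ∀ x, x ∈ E ↔ ∀ c : C, (ρ.jacquetModule t ⟨c, hCM c.2⟩ : _ →ₗ[k] _) x = χ' c • x)

include hE hCτ in
/-- `r(τ)` maps the `χ'`-eigenspace `E` of `C` into itself (`τ` commutes with `C`). [cite: BernsteinZelevinsky1976, §2.3] -/
theorem apply_jacquetModule_mem_eigen : ∀ x ∈ E, (ρ.jacquetModule t ⟨τ, hτ⟩ : _ →ₗ[k] _) x ∈ E := fun _ hx =>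
  LinearMap.apply_mem_eigen_of_comp_eq_comp hE (fun c => jacquetModule_comp_comm t hτ (hCM c.2) (hCτ c c.2)) hx

include h hact hact1 hperm htrN hrepR htr hrep_act hrep_id hsh hsh' hCτ hCR in
/-- **§2 — `r(τ) − 1` ON THE `χ'`-EIGENSPACE OF THE JACQUET MODULE**: injective, with cokernel of dimension `finrank (M_N⁽⁰⁾ ⊓ E)` (★ 4χ(a) §3 over ★ FILE 3's height grading).
[cite: Casselman1995, §6.3] [cite: Brown1982, III §5] -/
theorem finrank_quotient_range_jacquetModule_restrict_sub_id_eq :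
    Function.Injective ((ρ.jacquetModule t ⟨τ, hτ⟩ : _ →ₗ[k] _).restrict (apply_jacquetModule_mem_eigen t hτ C hCM hCτ χ' hE) - LinearMap.id : ↥E →ₗ[k] ↥E) ∧
      Module.finrank k (↥E ⧸ LinearMap.range
        ((ρ.jacquetModule t ⟨τ, hτ⟩ : _ →ₗ[k] _).restrict (apply_jacquetModule_mem_eigen t hτ C hCM hCτ χ' hE) - LinearMap.id : ↥E →ₗ[k] ↥E)) =
      Module.finrank k ↥((⨆ r ∈ {r | r ∈ R ∧ ht r = 0}, (Blk r).map (Coinvariants.mk (t.restrict ρ))) ⊓ E) := by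
  obtain ⟨hint, hinj, hshift⟩ := isInternal_heightPiece_jacquet_and_shift t h hact hact1 hperm rep tr htrN hrepR htr hrep_act hrep_id ht hτ hsh hsh'
  exact LinearMap.finrank_quotient_range_restrict_sub_id_eq hE hint
    (fun c n x hx => apply_jacquetModule_mem_heightPiece t hact hact1 hperm ht (hCM c.2) (hCR c c.2) n hx)
    (fun c => jacquetModule_comp_comm t hτ (hCM c.2) (hCτ c c.2)) hinj hshift _

include hE h hact hact1 hperm htrN hrepR htr hrep_act hrep_id hfd hCR in
/-- **§3 — THE DEGREE-ZERO EIGEN-PIECE SPLITS OVER THE REPRESENTATIVES**: `finrank (M_N⁽⁰⁾ ⊓ E) = Σ_{r ∈ R₀} finrank ([W_r] ⊓ E)` (★ 4χ(a) §4; independence from ★ FILE 2b).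
[cite: Casselman1995, §6.3] [cite: Brown1982, III §5] -/
theorem finrank_heightPiece_zero_inf_eigen_eq_sum (R₀ : Finset β) (hR₀ : ∀ r, r ∈ R₀ ↔ r ∈ R ∧ ht r = 0) :
    Module.finrank k ↥((⨆ r ∈ {r | r ∈ R ∧ ht r = 0}, (Blk r).map (Coinvariants.mk (t.restrict ρ))) ⊓ E) =
      ∑ r ∈ R₀, Module.finrank k ↥(((Blk r).map (Coinvariants.mk (t.restrict ρ))) ⊓ E) := by
  classical
  -- rewrite the set-builder sup as a `Finset` sup of the rep-normalised block images
  have hW0 : (⨆ r ∈ {r | r ∈ R ∧ ht r = 0}, (Blk r).map (Coinvariants.mk (t.restrict ρ))) =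
      ⨆ r ∈ R₀, (Blk (rep r)).map (Coinvariants.mk (t.restrict ρ)) := by
    refine le_antisymm (iSup₂_le fun r hr => ?_) (iSup₂_le fun r hr => ?_)
    · have hr' : r ∈ R₀ := (hR₀ r).2 hr
      rw [← hrep_id r hr.1]
      exact le_iSup₂_of_le r hr' le_rfl
    · have hr' := (hR₀ r).1 hr
      rw [hrep_id r hr'.1]
      exact le_iSup₂_of_le r (show r ∈ {r | r ∈ R ∧ ht r = 0} from hr') le_rfl
  haveI : ∀ r, FiniteDimensional k ↥((Blk (rep r)).map (Coinvariants.mk (t.restrict ρ))) := fun r => Module.Finite.map _ _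
  rw [hW0, LinearMap.finrank_biSup_inf_eigen_eq_sum hE (fun r => (Blk (rep r)).map (Coinvariants.mk (t.restrict ρ)))
    (fun c r x hx => by
      have hmap := map_jacquetModule_map_mk_block_eq t hact hact1 hperm (hCM c.2) (hCR c c.2 (rep r) (hrepR r))
      rw [← hmap]
      exact Submodule.mem_map_of_mem hx)
    R₀ (supIndep_map_mk_block_rep t h hact hact1 hperm rep tr htrN htr hrep_act hrep_id R₀ fun r hr => ((hR₀ r).1 hr).1)]
  exact Finset.sum_congr rfl fun r hr => by rw [hrep_id r ((hR₀ r).1 hr).1]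

include hE hCτ in
/-- `(r(τ) − 1)` commutes with every `r(c)`, `c ∈ C`, hence preserves `E`. [cite: BernsteinZelevinsky1976, §2.3] -/
theorem apply_jacquetModule_sub_id_mem_eigen :
    ∀ x ∈ E, (ρ.jacquetModule t ⟨τ, hτ⟩ - LinearMap.id : (t.restrict ρ).Coinvariants →ₗ[k] _) x ∈ E := by
  intro x hx
  rw [LinearMap.sub_apply, LinearMap.id_apply]
  exact Submodule.sub_mem _ (apply_jacquetModule_mem_eigen t hτ C hCM hCτ χ' hE x hx) hx

/-- The restriction of `r(τ) − 1` to `E` is `r(τ)|_E − 1` (so §2 computes its cokernel). [cite: Brown1982, III §5] -/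
theorem restrict_jacquetModule_sub_id_eq :
    (ρ.jacquetModule t ⟨τ, hτ⟩ - LinearMap.id : (t.restrict ρ).Coinvariants →ₗ[k] _).restrict (apply_jacquetModule_sub_id_mem_eigen t hτ C hCM hCτ χ' hE) =
      ((ρ.jacquetModule t ⟨τ, hτ⟩ : _ →ₗ[k] _).restrict (apply_jacquetModule_mem_eigen t hτ C hCM hCτ χ' hE) - LinearMap.id : ↥E →ₗ[k] ↥E) := by
  ext x
  simp [LinearMap.restrict_apply]

end Isotypic

/-! ## §4 The isotypic Euler identity -/

section Euler

variable {k G : Type*} [Field k] [CharZero k] [Group G] [TopologicalSpace G] [IsTopologicalGroup G] (t : ParabolicTriple G)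
variable {M₁ M₀ V : Type*} [AddCommGroup M₁] [Module k M₁] [AddCommGroup M₀] [Module k M₀] [AddCommGroup V] [Module k V]
variable {ρ₁ : Representation k G M₁} {ρ₀ : Representation k G M₀} {ρV : Representation k G V}
-- the short exact sequence and the topological input of Jacquet exactness
variable (hN : IsLimitOfCompactOpen t.N) (h₀ : ρ₀.IsSmooth) (f : ρ₁.IntertwiningMap ρ₀) (g : ρ₀.IntertwiningMap ρV)
  (hf : Function.Injective f) (hfg : Function.Exact f g) (hg : Function.Surjective g)
-- block data of `M₁`
variable {β₁ : Type*} [DecidableEq β₁] {Blk₁ : β₁ → Submodule k M₁} {act₁ : G → β₁ → β₁} (h₁ : DirectSum.IsInternal Blk₁)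
  (hact₁ : ∀ g g' b, act₁ (g * g') b = act₁ g (act₁ g' b)) (hact1₁ : ∀ b, act₁ 1 b = b) (hperm₁ : ∀ g b m, m ∈ Blk₁ b → ρ₁ g m ∈ Blk₁ (act₁ g b))
  {R₁ : Set β₁} (rep₁ : β₁ → β₁) (tr₁ : β₁ → G) (htrN₁ : ∀ b, tr₁ b ∈ t.N) (hrepR₁ : ∀ b, rep₁ b ∈ R₁) (htr₁ : ∀ b, act₁ (tr₁ b) (rep₁ b) = b)
  (hrep_act₁ : ∀ n ∈ t.N, ∀ b, rep₁ (act₁ n b) = rep₁ b) (hrep_id₁ : ∀ r ∈ R₁, rep₁ r = r) (ht₁ : β₁ → ℤ) (hfd₁ : ∀ b, FiniteDimensional k (Blk₁ b))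
-- block data of `M₀`
variable {β₀ : Type*} [DecidableEq β₀] {Blk₀ : β₀ → Submodule k M₀} {act₀ : G → β₀ → β₀} (h₀' : DirectSum.IsInternal Blk₀)
  (hact₀ : ∀ g g' b, act₀ (g * g') b = act₀ g (act₀ g' b)) (hact1₀ : ∀ b, act₀ 1 b = b) (hperm₀ : ∀ g b m, m ∈ Blk₀ b → ρ₀ g m ∈ Blk₀ (act₀ g b))
  {R₀ : Set β₀} (rep₀ : β₀ → β₀) (tr₀ : β₀ → G) (htrN₀ : ∀ b, tr₀ b ∈ t.N) (hrepR₀ : ∀ b, rep₀ b ∈ R₀) (htr₀ : ∀ b, act₀ (tr₀ b) (rep₀ b) = b)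
  (hrep_act₀ : ∀ n ∈ t.N, ∀ b, rep₀ (act₀ n b) = rep₀ b) (hrep_id₀ : ∀ r ∈ R₀, rep₀ r = r) (ht₀ : β₀ → ℤ) (hfd₀ : ∀ b, FiniteDimensional k (Blk₀ b))
-- the torus element, shifting both heights
variable {τ : G} (hτ : τ ∈ t.M) (hsh₁ : ∀ r ∈ R₁, ht₁ (rep₁ (act₁ τ r)) = ht₁ r + 1) (hsh₁' : ∀ r' ∈ R₁, ∃ r ∈ R₁, rep₁ (act₁ τ r) = r')
  (hsh₀ : ∀ r ∈ R₀, ht₀ (rep₀ (act₀ τ r)) = ht₀ r + 1) (hsh₀' : ∀ r' ∈ R₀, ∃ r ∈ R₀, rep₀ (act₀ τ r) = r')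
-- finiteness of `V_N`
variable (hVN : FiniteDimensional k (t.restrict ρV).Coinvariants)
-- the compact torus data and the three `χ'`-eigenspaces (hypothesis-style)
variable (C : Subgroup G) (hCM : C ≤ t.M) (hCτ : ∀ c ∈ C, c * τ = τ * c) (hCR₁ : ∀ c ∈ C, ∀ r ∈ R₁, act₁ c r = r) (hCR₀ : ∀ c ∈ C, ∀ r ∈ R₀, act₀ c r = r)
  (χ' : C → k)
  {E₁ : Submodule k (t.restrict ρ₁).Coinvariants} (hE₁ : ∀ x, x ∈ E₁ ↔ ∀ c : C, (ρ₁.jacquetModule t ⟨c, hCM c.2⟩ : _ →ₗ[k] _) x = χ' c • x)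
  {E₀ : Submodule k (t.restrict ρ₀).Coinvariants} (hE₀ : ∀ x, x ∈ E₀ ↔ ∀ c : C, (ρ₀.jacquetModule t ⟨c, hCM c.2⟩ : _ →ₗ[k] _) x = χ' c • x)
  {EV : Submodule k (t.restrict ρV).Coinvariants} (hEV : ∀ x, x ∈ EV ↔ ∀ c : C, (ρV.jacquetModule t ⟨c, hCM c.2⟩ : _ →ₗ[k] _) x = χ' c • x)
  (hsurj : ∀ z ∈ EV, ∃ y ∈ E₀, jacquetMap t g y = z)

include hN h₀ hf hfg hg h₁ hact₁ hact1₁ hperm₁ htrN₁ hrepR₁ htr₁ hrep_act₁ hrep_id₁ hfd₁ h₀' hact₀ hact1₀ hperm₀ htrN₀ hrepR₀ htr₀ hrep_act₀ hrep_id₀ hfd₀ hτ hsh₁ hsh₁' hsh₀ hsh₀' hVN hCτ hCR₁ hCR₀ hE₁ hE₀ hEV hsurj in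
/-- **THE ISOTYPIC EULER IDENTITY `Σ_{r ∈ S₁} dim ([W¹_r] ⊓ E₁) = Σ_{r ∈ S₀} dim ([W⁰_r] ⊓ E₀)`** for the `χ'`-eigenspaces of a subgroup `C ≤ M` commuting with `τ` and fixing the representatives,
in the setting of ★ FILE 4 (`0 → M₁ → M₀ → V → 0` by block-permutation modules, `V_N` finite-dimensional), given that `r(g)` maps `E₀` ONTO `E_V` (exactness of `χ'`-isotypic parts).
Proof: ★ FILE 4's Jacquet row + ★ 4χ(a) isotypic snake + §2 + §3 on both sides.  `[W^q_r] ⊓ E_q` = the `χ'`-eigenspace of `C` in `(V^{U_F})_{N ∩ P_F}` at the datum (47d's (E)).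
[cite: SchneiderStuhler1997, Ch. III §4] [cite: BernsteinZelevinsky1976, §2.3] [cite: Casselman1995, §6.3] -/
theorem sum_finrank_block_eigen_eq_of_shortExact (S₁ : Finset β₁) (hS₁ : ∀ r, r ∈ S₁ ↔ r ∈ R₁ ∧ ht₁ r = 0) (S₀ : Finset β₀)
    (hS₀ : ∀ r, r ∈ S₀ ↔ r ∈ R₀ ∧ ht₀ r = 0) :
    ∑ r ∈ S₁, Module.finrank k ↥(((Blk₁ r).map (Coinvariants.mk (t.restrict ρ₁))) ⊓ E₁) =
      ∑ r ∈ S₀, Module.finrank k ↥(((Blk₀ r).map (Coinvariants.mk (t.restrict ρ₀))) ⊓ E₀) := by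
  haveI := hVN
  obtain ⟨hF, hFG, hG, hab, hbc⟩ := jacquetMap_shortExact_sub_id t hN h₀ f g hf hfg hg ⟨τ, hτ⟩
  -- §2 + §3 on both sides
  have e₁ := (finrank_quotient_range_jacquetModule_restrict_sub_id_eq t h₁ hact₁ hact1₁ hperm₁ rep₁ tr₁ htrN₁ hrepR₁ htr₁ hrep_act₁ hrep_id₁ ht₁ hτ hsh₁ hsh₁'
    C hCM hCτ hCR₁ χ' hE₁).2
  have e₀ := (finrank_quotient_range_jacquetModule_restrict_sub_id_eq t h₀' hact₀ hact1₀ hperm₀ rep₀ tr₀ htrN₀ hrepR₀ htr₀ hrep_act₀ hrep_id₀ ht₀ hτ hsh₀ hsh₀'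
    C hCM hCτ hCR₀ χ' hE₀).2
  rw [finrank_heightPiece_zero_inf_eigen_eq_sum t h₁ hact₁ hact1₁ hperm₁ rep₁ tr₁ htrN₁ hrepR₁ htr₁ hrep_act₁ hrep_id₁ ht₁ hfd₁ C hCM hCR₁ χ' hE₁ S₁ hS₁] at e₁
  rw [finrank_heightPiece_zero_inf_eigen_eq_sum t h₀' hact₀ hact1₀ hperm₀ rep₀ tr₀ htrN₀ hrepR₀ htr₀ hrep_act₀ hrep_id₀ ht₀ hfd₀ C hCM hCR₀ χ' hE₀ S₀ hS₀] at e₀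
  rw [← e₁, ← e₀, ← restrict_jacquetModule_sub_id_eq t hτ C hCM hCτ χ' hE₁, ← restrict_jacquetModule_sub_id_eq t hτ C hCM hCτ χ' hE₀]
  -- the isotypic snake on the Jacquet row
  refine LinearMap.finrank_quotient_range_restrict_eq_of_exact (EC := EV) hE₁ hE₀ (jacquetMap t f).toLinearMap (jacquetMap t g).toLinearMap hF hFG _ _
    (ρV.jacquetModule t ⟨τ, hτ⟩ - LinearMap.id : (t.restrict ρV).Coinvariants →ₗ[k] _) hab hbc
    (injective_jacquetModule_sub_id t h₀' hact₀ hact1₀ hperm₀ rep₀ tr₀ htrN₀ hrepR₀ htr₀ hrep_act₀ hrep_id₀ ht₀ hτ hsh₀ hsh₀')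
    (fun c => ?_) (fun x hx => ?_) (fun y hy => ?_) _ _ (fun z hz => ?_) (fun z hz => ?_)
  · -- `r(f)` intertwines `r(c)`
    exact LinearMap.ext fun x => IntertwiningMap.isIntertwining _ _ (jacquetMap t f) ⟨c, hCM c.2⟩ x
  · exact LinearMap.apply_mem_eigen_of_mem_eigen hE₁ hE₀ (fun c => LinearMap.ext fun x => IntertwiningMap.isIntertwining _ _ (jacquetMap t f) ⟨c, hCM c.2⟩ x) hx
  · exact LinearMap.apply_mem_eigen_of_mem_eigen hE₀ hEV (fun c => LinearMap.ext fun x => IntertwiningMap.isIntertwining _ _ (jacquetMap t g) ⟨c, hCM c.2⟩ x) hy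
  · -- `(r_V(τ) − 1)` preserves `E_V`
    rw [LinearMap.sub_apply, LinearMap.id_apply]
    refine Submodule.sub_mem _ ?_ hz
    exact LinearMap.apply_mem_eigen_of_comp_eq_comp hEV (fun c => jacquetModule_comp_comm t hτ (hCM c.2) (hCτ c c.2)) hz
  · obtain ⟨y, hy, hyz⟩ := hsurj z hz
    exact ⟨y, hy, hyz⟩

end Euler

end Representation
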